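import Mathlib

/-!
# The characteristic-`2` cotangent derivation and the relation count (chain W4.1, crux `Steer`, B7)

OURS (campaign res-hironaka, rung L, slot W4.1; helper for crux `Steer` stmt-ResolutionOfSingularities-16345,
σ-residual LOW half, point-step layer of res-L0-w41-strat-2's one-step lemma B7 `rankFour_exit_two`). Pure local /
linear algebra; NOT a statement of any manuscript; nothing here is attributed to [claim: Hironaka2017,
status: under-review]. AI-written; weaker than expert review.

* §5 `exists_cotangentDerivation` — for a local ring `(R, 𝔪, κ)` of characteristic `2` whose residues are
  squares, the canonical cotangent derivation `δ : R → 𝔪/𝔪²`, `δ(a) = class of a − b²` for ANY `b` with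
  `a − b² ∈ 𝔪`: additive, Leibniz `δ(ab) = ā·δb + b̄·δa`, kills squares, and equal to the projection on `𝔪`
  (in cleaning language: the linear part of the best cleaning of `a` at the closed point);
* §6 `sum_polar_self_eq_zero` — the alternating self-pairing `Σ_k (Σ_j (b_{jk}+b_{kj}) v_j) v_k` vanishes in
  characteristic `2`; `exists_smul_of_two_relations` — two linear relations among `n + 1` vectors spanning an
  `n`-dimensional space are proportional (rank–nullity).
[folklore]
-/

noncomputable section

-- `Summit.<S>.<S>.…` duplicates the summit name by design (single-problem summit).
set_option linter.dupNamespace false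

namespace Summit.ResolutionOfSingularities.ResolutionOfSingularities.Theorems.SwitchingDichotomy.CotangentDerivation

open IsLocalRing Module

universe u v

variable {R : Type u} [CommRing R] [IsLocalRing R]

/-- `residue r • v = r • v` on the cotangent space. [folklore] -/
theorem residue_smul (r : R) (v : CotangentSpace R) : residue R r • v = r • v :=
  algebraMap_smul (ResidueField R) r v

/-! ## §5 The canonical characteristic-`2` cotangent derivation -/

/-- **The cotangent derivation `δ`** of a local ring of characteristic `2` whose residues are squares:
`δ(a) :=` the class of `a − b²` in `𝔪/𝔪²` for ANY `b` with `a − b² ∈ 𝔪` (two choices differ by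
`(b − b₀)² ∈ 𝔪²`). It is additive, satisfies Leibniz `δ(ab) = ā·δb + b̄·δa`, kills squares, and is the
projection `𝔪 → 𝔪/𝔪²` on `𝔪`. (In the cleaning language: `δ(f)` is the linear part of the best cleaning
of `f` at the closed point.) [folklore] -/
theorem exists_cotangentDerivation [CharP R 2] (hperf : ∀ a : R, ∃ b : R, a - b ^ 2 ∈ maximalIdeal R) :
    ∃ δ : R → CotangentSpace R,
      (∀ (a b : R) (h : a - b ^ 2 ∈ maximalIdeal R),
        δ a = (maximalIdeal R).toCotangent ⟨a - b ^ 2, h⟩) ∧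
      (∀ a b : R, δ (a + b) = δ a + δ b) ∧
      (∀ a b : R, δ (a * b) = residue R a • δ b + residue R b • δ a) ∧
      (∀ (m : R) (hm : m ∈ maximalIdeal R), δ m = (maximalIdeal R).toCotangent ⟨m, hm⟩) ∧
      (∀ b : R, δ (b ^ 2) = 0) := by
  have h2 : (2 : R) = 0 := by
    have := CharP.cast_eq_zero R 2
    simpa using this
  choose sq hsq using hperf
  let δ : R → CotangentSpace R := fun a => (maximalIdeal R).toCotangent ⟨a - sq a ^ 2, hsq a⟩
  -- well-definedness
  have hwd : ∀ (a b : R) (h : a - b ^ 2 ∈ maximalIdeal R),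
      δ a = (maximalIdeal R).toCotangent ⟨a - b ^ 2, h⟩ := by
    intro a b h
    show (maximalIdeal R).toCotangent ⟨a - sq a ^ 2, hsq a⟩ = _
    rw [Ideal.toCotangent_eq]
    have hdiff : b - sq a ∈ maximalIdeal R := by
      have hsq2 : (b - sq a) ^ 2 ∈ maximalIdeal R := by
        have e : (b - sq a) ^ 2 = (a - sq a ^ 2) - (a - b ^ 2) := by
          linear_combination (sq a ^ 2 - b * sq a) * h2
        rw [e]
        exact sub_mem (hsq a) h
      exact (Ideal.IsPrime.mem_of_pow_mem inferInstance 2 hsq2)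
    have e : ((⟨a - sq a ^ 2, hsq a⟩ : maximalIdeal R) : R) - ((⟨a - b ^ 2, h⟩ : maximalIdeal R) : R) =
        (b - sq a) ^ 2 := by
      show (a - sq a ^ 2) - (a - b ^ 2) = (b - sq a) ^ 2
      linear_combination (b * sq a - sq a ^ 2) * h2
    rw [e]
    exact Ideal.pow_mem_pow hdiff 2
  refine ⟨δ, hwd, ?_, ?_, ?_, ?_⟩
  · -- additive
    intro a b
    have h : a + b - (sq a + sq b) ^ 2 ∈ maximalIdeal R := by
      have e : a + b - (sq a + sq b) ^ 2 = (a - sq a ^ 2) + (b - sq b ^ 2) := by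
        linear_combination (-(sq a * sq b)) * h2
      rw [e]; exact add_mem (hsq a) (hsq b)
    rw [hwd (a + b) (sq a + sq b) h, hwd a (sq a) (hsq a), hwd b (sq b) (hsq b), ← map_add]
    congr 1
    apply Subtype.ext
    push_cast
    linear_combination (-(sq a * sq b)) * h2
  · -- Leibniz
    intro a b
    have h : a * b - (sq a * sq b) ^ 2 ∈ maximalIdeal R := by
      have e : a * b - (sq a * sq b) ^ 2 = a * (b - sq b ^ 2) + sq b ^ 2 * (a - sq a ^ 2) := by ring
      rw [e]
      exact add_mem (Ideal.mul_mem_left _ _ (hsq b)) (Ideal.mul_mem_left _ _ (hsq a))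
    rw [hwd (a * b) (sq a * sq b) h, hwd a (sq a) (hsq a), hwd b (sq b) (hsq b)]
    have hres : residue R b = residue R (sq b ^ 2) := by
      rw [← sub_eq_zero, ← map_sub, residue_eq_zero_iff]
      exact hsq b
    rw [hres, residue_smul, residue_smul, ← map_smul, ← map_smul, ← map_add]
    congr 1
    apply Subtype.ext
    push_cast
    simp only [smul_eq_mul]
    ring
  · -- on `𝔪`
    intro m hm
    have h : m - 0 ^ 2 ∈ maximalIdeal R := by simpa using hm
    rw [hwd m 0 h]
    congr 1
    apply Subtype.ext
    simp
  · -- squares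
    intro b
    have h : b ^ 2 - b ^ 2 ∈ maximalIdeal R := by simp
    rw [hwd (b ^ 2) b h]
    have : (⟨b ^ 2 - b ^ 2, h⟩ : maximalIdeal R) = 0 := Subtype.ext (by simp)
    rw [this, map_zero]

/-! ## §6 Two pieces of linear algebra for the point-step case -/

/-- **Alternating self-pairing vanishes** (characteristic `2`): `Σ_k (Σ_j (b_{jk} + b_{kj}) v_j) v_k = 0`.
[folklore] -/
theorem sum_polar_self_eq_zero {F : Type v} [CommRing F] [CharP F 2] {n : ℕ} (b : Fin n → Fin n → F)
    (v : Fin n → F) : ∑ k, (∑ j, (b j k + b k j) * v j) * v k = 0 := by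
  have h2 : (2 : F) = 0 := by
    have := CharP.cast_eq_zero F 2
    simpa using this
  have hS : ∑ k, (∑ j, b k j * v j) * v k = ∑ k, (∑ j, b j k * v j) * v k := by
    simp_rw [Finset.sum_mul]
    rw [Finset.sum_comm]
    exact Finset.sum_congr rfl fun k _ => Finset.sum_congr rfl fun j _ => by ring
  have e : ∑ k, (∑ j, (b j k + b k j) * v j) * v k =
      ∑ k, (∑ j, b j k * v j) * v k + ∑ k, (∑ j, b k j * v j) * v k := by
    rw [← Finset.sum_add_distrib]
    refine Finset.sum_congr rfl fun k _ => ?_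
    rw [← add_mul, ← Finset.sum_add_distrib]
    congr 1
    exact Finset.sum_congr rfl fun j _ => by ring
  rw [e, hS, ← two_mul, h2, zero_mul]

/-- **Two relations among `n + 1` vectors spanning an `n`-dimensional space are proportional**: if
`w₀, w_1, …, w_n` span `V` (`dim V = n`), `Σ c_j w_j + μ w₀ = 0` with `c ≠ 0`, and `Σ e_j w_j + λ w₀ = 0`, then
`e = t · c` for some scalar `t` (the relation space is one-dimensional). [folklore] -/
theorem exists_smul_of_two_relations {F : Type v} {V : Type u} [Field F] [AddCommGroup V] [Module F V]
    [FiniteDimensional F V] {n : ℕ} (hn : finrank F V = n) (w₀ : V) (w : Fin n → V)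
    (hspan : Submodule.span F (insert w₀ (Set.range w)) = ⊤)
    (c : Fin n → F) (μ : F) (hc : c ≠ 0) (hr₀ : ∑ j, c j • w j + μ • w₀ = 0)
    (e : Fin n → F) (lam : F) (hr₁ : ∑ j, e j • w j + lam • w₀ = 0) :
    ∃ t : F, ∀ j, e j = t * c j := by
  classical
  -- `L (t, d) = t • w₀ + Σ d_j • w_j`
  let L : (F × (Fin n → F)) →ₗ[F] V :=
    (LinearMap.fst F F (Fin n → F)).smulRight w₀ +
      (Fintype.linearCombination F w).comp (LinearMap.snd F F (Fin n → F))
  have hL : ∀ (t : F) (d : Fin n → F), L (t, d) = t • w₀ + ∑ j, d j • w j := by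
    intro t d
    simp [L, Fintype.linearCombination_apply]
  have hrange : LinearMap.range L = ⊤ := by
    rw [eq_top_iff, ← hspan, Submodule.span_le]
    rintro x (rfl | ⟨j, rfl⟩)
    · exact ⟨(1, 0), by rw [hL]; simp⟩
    · refine ⟨(0, Pi.single j 1), ?_⟩
      rw [hL, zero_smul, zero_add, Finset.sum_eq_single j]
      · simp
      · intro k _ hk; simp [Pi.single_eq_of_ne hk]
      · simp
  have hker : finrank F (LinearMap.ker L) = 1 := by
    have h := LinearMap.finrank_range_add_finrank_ker L
    rw [hrange, finrank_top, hn, Module.finrank_prod, Module.finrank_self,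
      Module.finrank_fintype_fun_eq_card, Fintype.card_fin] at h
    omega
  have hm₀ : ((μ, c) : F × (Fin n → F)) ∈ LinearMap.ker L := by
    rw [LinearMap.mem_ker, hL, add_comm]; exact hr₀
  have hm₁ : ((lam, e) : F × (Fin n → F)) ∈ LinearMap.ker L := by
    rw [LinearMap.mem_ker, hL, add_comm]; exact hr₁
  have hne : (⟨(μ, c), hm₀⟩ : LinearMap.ker L) ≠ 0 := by
    intro h0
    apply hc
    have := congrArg (fun z : LinearMap.ker L => (z : F × (Fin n → F)).2) h0
    simpa using this
  obtain ⟨t, ht⟩ := (finrank_eq_one_iff_of_nonzero' _ hne).mp hker ⟨(lam, e), hm₁⟩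
  refine ⟨t, fun j => ?_⟩
  have := congrArg (fun z : LinearMap.ker L => (z : F × (Fin n → F)).2 j) ht
  simpa [mul_comm] using this.symm

end Summit.ResolutionOfSingularities.ResolutionOfSingularities.Theorems.SwitchingDichotomy.CotangentDerivation

end
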